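import Mathlib.RepresentationTheory.Irreducible
import Mathlib.FieldTheory.IsAlgClosed.AlgebraicClosure
import Mathlib.LinearAlgebra.Matrix.ToLin
import Mathlib.Data.Matrix.Basis
import Literature.NumberTheory.GaloisRepresentations.ContinuousRep
import Literature.NumberTheory.Automorphic.RestrictedTensorProductIrreducibleProofs
import HarnessLib

/-!
# Burnside's theorem for matrix groups: the image spans `M_n` iff the representation is
# absolutely irreducible

For a homomorphism `φ : G → GL_n(k)` over a field `k` (`G` a monoid; a group for Burnside), write
`k⟨φ(G)⟩ ⊆ M_n(k)` for the `k`-span of the matrices `φ(g)`.  We prove the classical criterion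
(Burnside 1905; Curtis–Reiner (27.4); Lang, *Algebra*, XVII §3) in the form used to state "big
residual image" hypotheses without a residue map
(`Literature.NumberTheory.GaloisRepresentations.FramedRep.HasAbsolutelyIrreducibleReduction`):

* `span_range_map_eq_top_iff` — spanning `M_n` is insensitive to extension of scalars along a
  field homomorphism `f : k → L` (dimension count with a `k`-basis of the span);
* `isIrreducible_of_span_eq_top` — if `k⟨φ(G)⟩ = M_n(k)` and `n ≥ 1`, the representation of
  `G` on `kⁿ` is irreducible (a non-zero stable subspace is stable under all of `M_n(k)`);
* `span_eq_top_of_isIrreducible` — **Burnside**: over an algebraically closed field an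
  irreducible `φ` has `k⟨φ(G)⟩ = M_n(k)` (Schur's lemma, Mathlib
  `Representation.IsIrreducible.algebraMap_intertwiningMap_bijective_of_isAlgClosed`, and the
  Jacobson density theorem in the form `Representation.exists_asAlgebraHom_apply_eq` of the
  tree);
* `span_eq_top_iff_forall_isIrreducible` — hence, for `n ≥ 1`: `k⟨φ(G)⟩ = M_n(k)` iff `φ` is
  **absolutely irreducible**, i.e. irreducible after every extension of scalars `f : k → L`
  (fields `L` in the universe of `k`, the convention of `FramedRep.IsAbsolutelyIrreducible`).

The representation of `G` on `kⁿ` attached to `φ` is `(glStdRepresentation (Fin n) k).comp φ`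
(`ContinuousRep.lean`; this is `FramedRep.toRepresentation` / `FramedRep.baseChangeRepresentation`
for framed representations), irreducibility is Mathlib's `Representation.IsIrreducible`.
The rank-two special case with "no common eigenvector" in place of irreducibility is
`Literature.RepresentationTheory.Semisimple.span_eq_top_of_no_common_eigenvector`.

## References

* W. Burnside, *On the condition of reducibility of any group of linear substitutions*,
  Proc. London Math. Soc. 3 (1905), 430–434.
* C. W. Curtis, I. Reiner, *Representation theory of finite groups and associative algebras*
  (1962), (27.4).
-/

noncomputable section

open scoped MatrixGroups

open Matrix Module Literature.NumberTheory.GaloisRepresentations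

namespace Literature.RepresentationTheory.Semisimple

universe u

variable {k : Type u} [Field k] {n : ℕ}

section Monoid

variable {G : Type*} [Monoid G]

/-! ### Extension of scalars -/

/-- Entrywise, `(c • M).map f = f c • M.map f` for a ring homomorphism `f`. [folklore] -/
lemma map_smul_eq_smul_map {L : Type*} [Field L] (f : k →+* L) (c : k)
    (M : Matrix (Fin n) (Fin n) k) : (c • M).map f = f c • M.map f := by
  ext a b
  simp

/-- **Spanning `M_n` is insensitive to extension of scalars.** For a family of matrices
`X i ∈ M_n(k)` and a field homomorphism `f : k → L`, the `f(X i)` span `M_n(L)` over `L` iff the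
`X i` span `M_n(k)` over `k`: "if" by pushing a `k`-linear combination giving each elementary
matrix through `f`; "only if" because the `f(X i)` lie in the `L`-span of the image of a `k`-basis
of `k⟨X⟩`, which has `dim_k k⟨X⟩ ≤ n²` elements. [folklore] -/
theorem span_range_map_eq_top_iff {L : Type*} [Field L] (f : k →+* L) {ι : Type*}
    (X : ι → Matrix (Fin n) (Fin n) k) :
    Submodule.span L (Set.range fun i => (X i).map f) = ⊤ ↔
      Submodule.span k (Set.range X) = ⊤ := by
  classical
  constructor
  · intro hL
    set S := Submodule.span k (Set.range X) with hS
    let b := Module.finBasis k S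
    -- every `f(X i)` lies in the `L`-span of the images of the basis `b`
    have hsub : Submodule.span L (Set.range fun i => (X i).map f) ≤
        Submodule.span L (Set.range fun j => ((b j : S) : Matrix (Fin n) (Fin n) k).map f) := by
      refine Submodule.span_le.2 ?_
      rintro _ ⟨i, rfl⟩
      have hXi : X i ∈ S := Submodule.subset_span ⟨i, rfl⟩
      have hrepr : X i = ∑ j, b.repr ⟨X i, hXi⟩ j • ((b j : S) : Matrix (Fin n) (Fin n) k) := by
        have h := congrArg Subtype.val (b.sum_repr ⟨X i, hXi⟩)
        rw [Submodule.coe_sum] at h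
        simp_rw [Submodule.coe_smul] at h
        exact h.symm
      change (X i).map f ∈ _
      rw [hrepr, ← RingHom.mapMatrix_apply, map_sum]
      refine Submodule.sum_mem _ fun j _ => ?_
      rw [RingHom.mapMatrix_apply, map_smul_eq_smul_map]
      exact Submodule.smul_mem _ _ (Submodule.subset_span ⟨j, rfl⟩)
    have hle : Module.finrank L (Matrix (Fin n) (Fin n) L) ≤ Module.finrank k S := by
      rw [← finrank_top, ← hL]
      refine (Submodule.finrank_mono hsub).trans ((finrank_range_le_card _).trans ?_)
      rw [Fintype.card_fin]
    have hd : Module.finrank k S ≤ Module.finrank k (Matrix (Fin n) (Fin n) k) :=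
      Submodule.finrank_le S
    have hmat : Module.finrank L (Matrix (Fin n) (Fin n) L) =
        Module.finrank k (Matrix (Fin n) (Fin n) k) := by
      simp [Module.finrank_matrix]
    exact Submodule.eq_top_of_finrank_eq (le_antisymm hd (hmat ▸ hle))
  · intro hk
    refine eq_top_iff.2 ?_
    rintro M -
    rw [Matrix.matrix_eq_sum_single M]
    refine Submodule.sum_mem _ fun i _ => Submodule.sum_mem _ fun j _ => ?_
    -- `single i j (M i j) = M i j • f(single i j 1)` and `single i j 1 ∈ k⟨X⟩` pushes through `f`
    have hk1 : Matrix.single i j (1 : k) ∈ Submodule.span k (Set.range X) := by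
      rw [hk]; exact Submodule.mem_top
    obtain ⟨c, hc⟩ := Finsupp.mem_span_range_iff_exists_finsupp.1 hk1
    have h1 : Matrix.single i j (M i j) = M i j • (Matrix.single i j (1 : k)).map f := by
      rw [Matrix.map_single, map_one, Matrix.smul_single, smul_eq_mul, mul_one]
    rw [h1, ← hc, Finsupp.sum, ← RingHom.mapMatrix_apply, map_sum]
    refine Submodule.smul_mem _ _ (Submodule.sum_mem _ fun t _ => ?_)
    rw [RingHom.mapMatrix_apply, map_smul_eq_smul_map]
    exact Submodule.smul_mem _ _ (Submodule.subset_span ⟨t, rfl⟩)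

/-! ### Spanning `M_n` implies irreducibility -/

/-- If the matrices `φ(g)` span `M_n(k)` (`n ≥ 1`), the representation of `G` on `kⁿ` is
irreducible: a stable subspace is stable under the span `M_n(k)` of the `φ(g)`, and `M_n(k)`
moves any non-zero vector to any vector. [folklore] -/
theorem isIrreducible_of_span_eq_top (hn : 0 < n) (φ : G →* GL (Fin n) k)
    (h : Submodule.span k (Set.range fun g => ((φ g : GL (Fin n) k) : Matrix (Fin n) (Fin n) k)) = ⊤) :
    Representation.IsIrreducible ((glStdRepresentation (Fin n) k).comp φ) := by
  classical
  set R : Representation k G (Fin n → k) := (glStdRepresentation (Fin n) k).comp φ with hR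
  haveI : Nonempty (Fin n) := ⟨⟨0, hn⟩⟩
  have hbot : (⊥ : Subrepresentation R).toSubmodule = ⊥ := rfl
  have htop : (⊤ : Subrepresentation R).toSubmodule = ⊤ := rfl
  haveI : Nontrivial (Subrepresentation R) := ⟨⟨⊥, ⊤, fun h' => by
    have h'' := congrArg Subrepresentation.toSubmodule h'
    rw [hbot, htop] at h''
    exact bot_ne_top h''⟩⟩
  refine ⟨fun W => ?_⟩
  by_cases hW : W.toSubmodule = ⊥
  · exact Or.inl (Subrepresentation.toSubmodule_injective (by rw [hW, hbot]))
  · right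
    obtain ⟨w, hwW, hw0⟩ := Submodule.exists_mem_ne_zero_of_ne_bot hW
    obtain ⟨j₀, hj₀⟩ : ∃ j, w j ≠ 0 := by
      by_contra! h0
      exact hw0 (funext h0)
    -- `W` is stable under every matrix, since it is stable under the spanning set `φ(G)`
    have hstab : ∀ M : Matrix (Fin n) (Fin n) k, ∀ v ∈ W.toSubmodule, M *ᵥ v ∈ W.toSubmodule := by
      intro M
      have hM : M ∈ Submodule.span k
          (Set.range fun g => ((φ g : GL (Fin n) k) : Matrix (Fin n) (Fin n) k)) := by
        rw [h]; exact Submodule.mem_top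
      refine Submodule.span_induction (p := fun M _ => ∀ v ∈ W.toSubmodule, M *ᵥ v ∈ W.toSubmodule)
        ?_ ?_ ?_ ?_ hM
      · rintro _ ⟨g, rfl⟩ v hv
        exact W.apply_mem_toSubmodule g hv
      · intro v _
        rw [Matrix.zero_mulVec]
        exact W.toSubmodule.zero_mem
      · intro M N _ _ hM hN v hv
        rw [Matrix.add_mulVec]
        exact W.toSubmodule.add_mem (hM v hv) (hN v hv)
      · intro c M _ hM v hv
        rw [Matrix.smul_mulVec]
        exact W.toSubmodule.smul_mem c (hM v hv)
    refine Subrepresentation.toSubmodule_injective ?_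
    rw [htop, eq_top_iff]
    rintro v -
    -- the matrix with `j₀`-th column `v / w j₀` sends `w` to `v`
    let M : Matrix (Fin n) (Fin n) k := Matrix.of fun i j => if j = j₀ then v i * (w j₀)⁻¹ else 0
    have hMw : M *ᵥ w = v := by
      ext i
      simp [M, Matrix.mulVec, dotProduct, hj₀]
    rw [← hMw]
    exact hstab M w hwW

end Monoid

section Group

variable {G : Type*} [Group G]

/-! ### Burnside: irreducible over an algebraically closed field implies spanning -/

/-- **Burnside's theorem.** If `k` is algebraically closed and the representation of `G` on `kⁿ`
through `φ : G → GL_n(k)` is irreducible, the matrices `φ(g)` span `M_n(k)`: by Schur's lemma the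
intertwiners are the scalars, so by the Jacobson density theorem the group algebra maps onto
`End_k(kⁿ) = M_n(k)`. (Curtis–Reiner (27.4).) [folklore] -/
theorem span_eq_top_of_isIrreducible [IsAlgClosed k] (φ : G →* GL (Fin n) k)
    [hirr : Representation.IsIrreducible ((glStdRepresentation (Fin n) k).comp φ)] :
    Submodule.span k (Set.range fun g => ((φ g : GL (Fin n) k) : Matrix (Fin n) (Fin n) k)) = ⊤ := by
  classical
  set M : G → Matrix (Fin n) (Fin n) k := fun g => ((φ g : GL (Fin n) k) : Matrix (Fin n) (Fin n) k)
    with hMdef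
  set R : Representation k G (Fin n → k) := (glStdRepresentation (Fin n) k).comp φ with hRdef
  have hRlin : ∀ g, R g = Matrix.toLin' (M g) := fun g =>
    LinearMap.ext fun v => by rw [Matrix.toLin'_apply]; rfl
  -- Schur's lemma (Mathlib): intertwiners of an irreducible representation are scalars
  have hs : ∀ T : (Fin n → k) →ₗ[k] (Fin n → k), (∀ g : G, T ∘ₗ R g = R g ∘ₗ T) →
      ∃ c : k, T = c • LinearMap.id := by
    intro T hT
    obtain ⟨c, hc⟩ :=
      (Representation.IsIrreducible.algebraMap_intertwiningMap_bijective_of_isAlgClosed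
        (ρ := R)).2 ⟨T, hT⟩
    refine ⟨c, LinearMap.ext fun v => ?_⟩
    have hv : (c • (1 : Representation.IntertwiningMap R R)) v = T v := by
      rw [← Representation.IntertwiningMap.algebraMap_apply, hc]; rfl
    rw [Representation.IntertwiningMap.smul_apply, Representation.IntertwiningMap.coe_one,
      id_eq] at hv
    rw [LinearMap.smul_apply, LinearMap.id_apply]
    exact hv.symm
  -- Jacobson density
  rw [eq_top_iff]
  rintro X -
  obtain ⟨r, hr⟩ := Representation.exists_asAlgebraHom_apply_eq (ρ := R) hs
    (Finset.univ.image fun i : Fin n => (Pi.single i 1 : Fin n → k)) (Matrix.toLin' X)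
  have hrX : R.asAlgebraHom r = Matrix.toLin' X := by
    refine (Pi.basisFun k (Fin n)).ext fun i => ?_
    rw [Pi.basisFun_apply]
    exact hr _ (Finset.mem_image.mpr ⟨i, Finset.mem_univ _, rfl⟩)
  have hmem : R.asAlgebraHom r ∈
      Submodule.span k (Set.range fun g => (R g : (Fin n → k) →ₗ[k] (Fin n → k))) := by
    rw [Representation.asAlgebraHom_def, MonoidAlgebra.lift_apply, Finsupp.sum]
    exact Submodule.sum_mem _ fun g _ => Submodule.smul_mem _ _ (Submodule.subset_span ⟨g, rfl⟩)
  have himage := Submodule.mem_map_of_mem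
    (f := (LinearMap.toMatrix' : ((Fin n → k) →ₗ[k] (Fin n → k)) ≃ₗ[k]
      Matrix (Fin n) (Fin n) k).toLinearMap) hmem
  rw [hrX, Submodule.map_span, ← Set.range_comp] at himage
  have hX : (LinearMap.toMatrix' : ((Fin n → k) →ₗ[k] (Fin n → k)) ≃ₗ[k] _).toLinearMap
      (Matrix.toLin' X) = X :=
    LinearMap.toMatrix'_toLin' X
  rw [hX] at himage
  have hcomp : ((LinearMap.toMatrix' : ((Fin n → k) →ₗ[k] (Fin n → k)) ≃ₗ[k] _).toLinearMap ∘
      fun g => (R g : (Fin n → k) →ₗ[k] (Fin n → k))) = M := by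
    funext g
    simp only [Function.comp_apply, LinearEquiv.coe_coe, hRlin, LinearMap.toMatrix'_toLin']
  rw [hcomp] at himage
  exact himage

/-! ### Spanning `M_n` iff absolutely irreducible -/

/-- Matrices of the extension of scalars of `φ` along `f`. [folklore] -/
lemma coe_map_comp_apply {L : Type*} [Field L] (f : k →+* L) (φ : G →* GL (Fin n) k) (g : G) :
    (((Matrix.GeneralLinearGroup.map f).comp φ g : GL (Fin n) L) : Matrix (Fin n) (Fin n) L) =
      ((φ g : GL (Fin n) k) : Matrix (Fin n) (Fin n) k).map f := rfl

/-- **`k⟨φ(G)⟩ = M_n(k)` iff `φ` is absolutely irreducible** (`n ≥ 1`): the matrices `φ(g)`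
span `M_n(k)` iff for every field homomorphism `f : k → L` (`L` in the universe of `k`) the
representation of `G` on `Lⁿ` through `f ∘ φ` is irreducible.  "Only if": spanning passes to
`L` (`span_range_map_eq_top_iff`) and implies irreducibility; "if": apply Burnside over an
algebraic closure `k̄` of `k` and descend the spanning back to `k`. (Curtis–Reiner (27.4),
(29.13).) [folklore] -/
theorem span_eq_top_iff_forall_isIrreducible (hn : 0 < n) (φ : G →* GL (Fin n) k) :
    Submodule.span k (Set.range fun g => ((φ g : GL (Fin n) k) : Matrix (Fin n) (Fin n) k)) = ⊤ ↔
      ∀ (L : Type u) [Field L] (f : k →+* L),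
        Representation.IsIrreducible
          ((glStdRepresentation (Fin n) L).comp ((Matrix.GeneralLinearGroup.map f).comp φ)) := by
  constructor
  · intro h L _ f
    refine isIrreducible_of_span_eq_top hn _ ?_
    simp_rw [coe_map_comp_apply]
    exact (span_range_map_eq_top_iff f _).2 h
  · intro h
    haveI := h (AlgebraicClosure k) (algebraMap k (AlgebraicClosure k))
    have hspan := span_eq_top_of_isIrreducible
      ((Matrix.GeneralLinearGroup.map (algebraMap k (AlgebraicClosure k))).comp φ)
    simp_rw [coe_map_comp_apply] at hspan
    exact (span_range_map_eq_top_iff _ _).1 hspan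

end Group

end Literature.RepresentationTheory.Semisimple
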